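import Mathlib.Topology.Order.DenselyOrdered
import Mathlib.Topology.Order.OrderClosed
import Summits.CriticalPhenomena.SAWScalingLimit.Theorems.SAWLeftRightFKGLeftRightFKGDefs
import Summits.CriticalPhenomena.SAWScalingLimit.Theorems.SAWLeftRightFKGLeftRightFKGStubEndpointMonotoneAux
import Literature.Probability.RandomPlanarGeometry.SelfAvoidingWalkProofs
import HarnessLib

/-!
# Stub `stub_cornerContinuity` of line `corner-localisation`: corner positivity is closed from below

Crux `LeftRightFKG` (stmt-CriticalPhenomena-11232), line corner-localisation (lead c1 reshape v5), stub
`stub_cornerContinuity`; vocabulary module `…LeftRightFKGDefs` (`Corner x := PAfor x true true`,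
`CornerCritical := Corner x_c`, `μx`, `restrP`, `finite_domainSAW`) and the dictionary
`EndpointMonotone.μx_bi_iff` of `…StubEndpointMonotoneAux`.

THE STRUCTURAL FACT: corner positivity is CLOSED FROM BELOW in the fugacity — if `Corner x` holds for
every subcritical fugacity `0 < x < x_c` then it holds at `x_c = SAW.criticalFugacity`.

Proof. Fix a crux instance, a prefix/suffix class, an end-step restriction `Γ = restrP k π m σ Sa Sb` and
the events `A`, `B`. The chord type is finite (`finite_domainSAW`, `δ > 0`), so for `x ≥ 0` the measure
inequality `μ(A ∩ Γ) μ(B ∩ Γ) ≤ μ(Γ) μ(A ∩ B ∩ Γ)` for `μ = μx x` is, by `μx_bi_iff`, the real inequality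
`F x ≤ G x` between products of finite sums of powers `x ^ |γ|`; both sides are continuous (polynomial)
in `x`, the inequality holds on `(0, x_c)` by hypothesis, and `x_c ∈ closure (0, x_c) = [0, x_c]` since
`x_c > 0` (`SAW.criticalFugacity_pos_lt_one'`); conclude with `le_on_closure`. Same limit argument as
the sibling `BoundaryTP2.graphTP2At_criticalFugacity_of_subcritical`. [folklore]
-/

noncomputable section

open MeasureTheory
open Finset
open Literature.Probability.LatticeModels Literature.Probability.RandomPlanarGeometry
open scoped Classical ENNReal

namespace Summit.CriticalPhenomena.SAWScalingLimit.Theorems.LeftRightFKG.CornerLoc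

namespace CornerContinuity

/-- A real partition function `x ↦ Σ_{γ ∈ t} x^{|γ|}` over a finite set of chords is continuous
(a finite sum of powers). [folklore] -/
theorem continuous_partSum {Ω : Set ℂ} {δ : ℝ} {a b : Site 2} (t : Finset (SAW.DomainSAW Ω δ a b)) :
    Continuous fun x : ℝ => ∑ γ ∈ t, x ^ γ.length :=
  continuous_finsetSum _ fun γ _ => continuous_pow γ.length

/-- `x_c` lies in the closure of the subcritical interval `(0, x_c)`, because `x_c > 0`. [folklore] -/
theorem criticalFugacity_mem_closure_Ioo :
    SAW.criticalFugacity ∈ closure (Set.Ioo 0 SAW.criticalFugacity) := by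
  have hxc : 0 < SAW.criticalFugacity := SAW.criticalFugacity_pos_lt_one'.1
  rw [closure_Ioo hxc.ne]
  exact ⟨hxc.le, le_rfl⟩

/-- CORNER POSITIVITY IS CLOSED FROM BELOW: `Corner x` for all `0 < x < x_c` gives `Corner x_c`, by
continuity of the (polynomial) partition functions of the finite chord type and `le_on_closure` at
`x_c ∈ closure (0, x_c)`. [folklore] -/
theorem cornerCritical_of_subcritical
    (h : ∀ x : ℝ, 0 < x → x < SAW.criticalFugacity → Corner x) : CornerCritical := by
  intro δ c a b a' b' C hI k π m σ Sa Sb A B hA hB hN hP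
  have hxc : 0 < SAW.criticalFugacity := SAW.criticalFugacity_pos_lt_one'.1
  haveI : Fintype (SAW.DomainSAW (dom C δ) δ a b) :=
    @Fintype.ofFinite _ (finite_domainSAW C hI.1)
  rw [EndpointMonotone.μx_bi_iff hxc.le]
  set s : Finset (SAW.DomainSAW (dom C δ) δ a b) := univ.filter (· ∈ restrP k π m σ Sa Sb) with hs
  -- the real inequality on `(0, x_c)`, from the hypothesis applied to the same instance
  have hsub : ∀ x ∈ Set.Ioo 0 SAW.criticalFugacity,
      (∑ γ ∈ s.filter (· ∈ A), x ^ γ.length) * (∑ γ ∈ s.filter (· ∈ B), x ^ γ.length) ≤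
        (∑ γ ∈ s, x ^ γ.length) * ∑ γ ∈ (s.filter (· ∈ A)).filter (· ∈ B), x ^ γ.length := by
    intro x hx
    have hx' := (EndpointMonotone.μx_bi_iff hx.1.le A B (restrP k π m σ Sa Sb)).1
      (h x hx.1 hx.2 δ c a b a' b' C hI k π m σ Sa Sb A B hA hB hN hP)
    rw [← hs] at hx'
    exact hx'
  -- pass to the closed endpoint `x_c ∈ closure (0, x_c)`
  exact le_on_closure
    (f := fun x : ℝ => (∑ γ ∈ s.filter (· ∈ A), x ^ γ.length) * ∑ γ ∈ s.filter (· ∈ B), x ^ γ.length)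
    (g := fun x : ℝ => (∑ γ ∈ s, x ^ γ.length) * ∑ γ ∈ (s.filter (· ∈ A)).filter (· ∈ B), x ^ γ.length)
    hsub ((continuous_partSum _).mul (continuous_partSum _)).continuousOn
    ((continuous_partSum _).mul (continuous_partSum _)).continuousOn
    criticalFugacity_mem_closure_Ioo

end CornerContinuity

/-- REGISTERED STUB `stub_cornerContinuity` of line `corner-localisation` (structural, fugacity
limit): corner positivity is CLOSED FROM BELOW in the fugacity — if `Corner x` holds for every
subcritical `0 < x < x_c` then it holds at the critical fugacity `x_c` (finite chord type, polynomial
partition functions, `le_on_closure`). [folklore] -/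
theorem stub_cornerContinuity :
    (∀ x : ℝ, 0 < x → x < SAW.criticalFugacity → Corner x) → CornerCritical :=
  CornerContinuity.cornerCritical_of_subcritical

end Summit.CriticalPhenomena.SAWScalingLimit.Theorems.LeftRightFKG.CornerLoc

end
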